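import Summits.ResolutionOfSingularities.ResolutionOfSingularities.Theorems.MarkedTransferCampaignW46CuspStaircaseClosedPoint
import Summits.ResolutionOfSingularities.ResolutionOfSingularities.Theorems.MarkedTransferCampaignW46CuspStaircaseExitBound
import Summits.ResolutionOfSingularities.ResolutionOfSingularities.Theorems.MarkedTransferCampaignW46MohWindowNabla
import HarnessLib

/-!
# [OURS · L1 W4.6, rung (iii)] The cusp staircase, IX — the regimes PROPAGATE along the typed procedure: the every-stage
# hypothesis (DESIGN POINT (REG)) of the curve rungs is discharged from the INPUT alone
# (cell res-hironaka, LADDER-RESOLUTION rung L, D-0089; slot W4.6, seat res-L1-s46-pv-5 gen 3; host route MarkedTransfer,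
# `--kind proof --supports stmt-ResolutionOfSingularities-16155 --as helper`)

HONEST FRAMING. Everything below is OURS: kernel theorems about the campaign definitions `CampaignW46.Regime.mohWindowCurve`
(`…MohWindow.lean`, p472581) and `CampaignW46.Regime.cuspCurve` (`…CuspStaircase.lean`, p482083) over the shared typed-
procedure module `…TypedProcedure.lean` (res-L1-type-o1: `Step`, `Run`, `RunFrom`, `RunNabla`, `RunFromNabla`, `Terminates`,
`DivergesFrom`, `DivergesFromNabla`). NOTHING here is a statement of H. Hironaka's manuscript *Resolution of singularities
in positive characteristics* (2017-03-23, [Hironaka2017]) and nothing here asserts that any statement of it holds; the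
manuscript enters only through the typed CANDIDATE carriers (row 001 `IdealExponent`, `sing`, `transform`; the résumé and
centre rule of Th. 16.6 p.84 l.4–8 as typed). No FACT-LIST premise is used. AI review is weaker than expert review. No
`sorry`; axioms standard.

## What is proved (namespace `…Theorems.CampaignW46`; every `p`, every field `K` of characteristic `p`, every `N`, `Rd`)

The landed rungs `mohWindowCurveTerminates_holds` / `cuspCurveTerminates_holds` (`…MohWindowProof.lean` p473117,
`…CuspStaircaseDescent.lean` p483211) say: there is no infinite run of the typed Th. 16.6 procedure ALL OF WHOSE STAGES lie in
the regime (the regime is a HYPOTHESIS at every stage — DESIGN POINT (REG); slot text «state the Moh window as a hypothesis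
on EVERY step»). This file removes the every-stage hypothesis for these two curve regimes:

* `Step.mohWindowCurve_transform`, `Step.cuspCurve_transform` — **the regimes are stable under every step admitted by the
  typed centre rule**: if `(Z, E) ∈ Regime.mohWindowCurve` (resp. `Regime.cuspCurve`) and `s` is any typed step from a
  résumé of `E`, then `(Z′, E′)` is again in the regime. Ingredients: the centre is a closed singular point `ξ`
  (`IsCentre.exists_eq_singleton_of_*`); off `ξ` the blow-up is a local isomorphism carrying `J_{π x′}` onto `J′_{x′}`
  (tree `stalkIdeal_controlledTransform_of_not_mem_support`; germ predicates transported by `Cusp.cuspAt_map_of_ringEquiv`,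
  `Cusp.mohWindowAt_map_of_ringEquiv`) and is injective (`MohWindow.injOn_preimage_compl`, so `{x′} = π⁻¹{π x′}` is
  closed); over `ξ` there is no singular point in the window (`MohWindow.idealOrder_controlledTransform_lt`) and on the
  staircase the singular point is the chart origin, again a cusp point (`Step.cuspAt_and_cuspIndexAt_le_of_over`) and
  CLOSED (`Cusp.isClosed_singleton_of_le`, file VIII `…CuspStaircaseClosedPoint.lean`); `Sing(E′)` is finite
  (`Step.sing_finite_of_mohWindowCurve`, `Step.sing_finite_and_ncard_le_of_cuspCurve`).
* `Run.mohWindowCurve_of_zero`, `Run.cuspCurve_of_zero` — along a run, the regime at stage `0` forces it at every stage.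
* `Run.not_mohWindowCurve_zero`, `Run.not_cuspCurve_zero` — **no infinite run of the typed procedure STARTS at a state of
  the regime** (any `N`, any `Rd`; no hypothesis on later stages).
* `not_divergesFrom_of_mohWindowCurve`, `not_divergesFromNabla_of_mohWindowCurve`, `not_divergesFrom_of_cuspCurve`,
  `not_divergesFromNabla_of_cuspCurve` — the same in the `RunFrom` / `RunFromNabla` bookkeeping of the W4.7 negative side:
  for EVERY regime `Rg` (in particular `Regime.top`), `¬ DivergesFrom N Rd Rg A₀ E₀` and `¬ DivergesFromNabla N Rd Rg A₀ E₀`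
  whenever `(A₀, E₀)` is a window / staircase state. With `Run.exists_exit_le_sum_div_of_cuspCurve` (p486759) this reads:
  a run from a staircase input would have to leave the regime by stage `Σ(E₀)/b`, and cannot.

What is NOT here: the scheme-level non-vacuity instance `(𝔸²_K, ((y^p + xⁿ), p))` (seat pv-13) and the surface window
(seat pv-12); nothing is claimed for `b ∣ d` or outside ambient dimension `2` at the singular points.

## References

* This seat: `…MohWindow*.lean` (p472581, p473117, p477012, p477204), `…CuspStaircase*.lean` (p482083 … p486759),
  `…CuspStaircaseClosedPoint.lean` (file VIII); RUNG-MAP-W46.md §RUNG (iii) (res-L1-type-o1); plan/RESCUE-SEED.md §1 W4.6.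
* The Stacks Project, Tags 0804, 02OS, 01TB. [cite: StacksProject, Tag 0804]
* H. Hironaka, ms. 2017-03-23, Th. 16.6 p.84 l.4–20, Th. 16.13 p.87 l.26–28, §2.1 p.4 l.34–39 — scope only, under
  adjudication, not cited as fact. [Hironaka2017]
-/

noncomputable section

set_option linter.dupNamespace false -- mandated namespace of this single-conjunct summit

open CategoryTheory AlgebraicGeometry TopologicalSpace IsLocalRing

namespace Summit.ResolutionOfSingularities.ResolutionOfSingularities.Theorems

namespace CampaignW46

open Literature.AlgebraicGeometry.Resolution
open Literature.AlgebraicGeometry.Hironaka2017.S02Preliminaries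
open Literature.AlgebraicGeometry.Hironaka2017.Datum
open Scheme.IdealSheafData

universe u

/-! ## Ring level: the germ predicates are transported along ring isomorphisms -/

namespace Cusp

/-- `CuspAt` is transported along ring isomorphisms (from `cuspShape_map_of_ringEquiv`). [folklore] -/
theorem cuspAt_map_of_ringEquiv {b : ℕ} {R R' : Type u} [CommRing R] [IsLocalRing R] [CommRing R']
    [IsLocalRing R'] (e : R ≃+* R') {I : Ideal R} (h : CuspAt b R I) :
    CuspAt b R' (I.map (e : R →+* R')) := by
  obtain ⟨d, hnd, hs⟩ := h
  exact ⟨d, hnd, cuspShape_map_of_ringEquiv e hs⟩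

/-- `MohWindowAt` is transported along ring isomorphisms. [folklore] -/
theorem mohWindowAt_map_of_ringEquiv {b : ℕ} {R R' : Type u} [CommRing R] [IsLocalRing R] [CommRing R']
    [IsLocalRing R'] (e : R ≃+* R') {I : Ideal R} (h : MohWindowAt b R I) :
    MohWindowAt b R' (I.map (e : R →+* R')) := by
  obtain ⟨hreg, hdim, x, y, hxy, d, u, hu, hbd, hd2, hI⟩ := h
  haveI := hreg
  refine ⟨IsRegularLocalRing.of_ringEquiv e, ?_, e x, e y, ?_, d, e u, hu.map e, hbd, hd2, ?_⟩
  · rw [← map_ringEquiv_maximalIdeal e, Ideal.spanFinrank_map_eq_of_ringEquiv, hdim]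
  · rw [← map_ringEquiv_maximalIdeal e, ← hxy, Ideal.map_span, Set.image_pair]
  · rw [hI, Ideal.map_span, Set.image_singleton]
    simp only [RingHom.coe_coe, map_add, map_pow, map_mul]

end Cusp

section Campaign

variable {n : ℕ} {p : ℕ} [Fact p.Prime] {K : Type u} [Field K] [CharP K p]
variable {N : Notions.{u} n} {A A' : AmbientDatum p K} {E : IdealExponent A.Z} {R : Resume N A E}

/-! ## One step: off the centre -/

/-- **Off the centre, points over closed points are closed.** For a typed step `s` (a blow-up along the reduced ideal of
the centre `D`) and a point `x′ ∈ Z′` with `π x′ ∉ D` and `{π x′}` closed: `{x′} = π⁻¹{π x′}` (the blow-up is injective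
off `π⁻¹(D)`, `MohWindow.injOn_preimage_compl`), a closed set. [cite: StacksProject, Tag 02OS] -/
theorem Step.isClosed_singleton_of_not_mem (s : Step R A') {x' : A'.Z} (hx : s.π.base x' ∉ (s.D : Set A.Z))
    (hcl : IsClosed ({s.π.base x'} : Set A.Z)) : IsClosed ({x'} : Set A'.Z) := by
  have heq : ({x'} : Set A'.Z) = s.π.base ⁻¹' {s.π.base x'} := by
    ext z
    simp only [Set.mem_singleton_iff, Set.mem_preimage]
    constructor
    · rintro rfl
      rfl
    · intro hz
      refine MohWindow.injOn_preimage_compl s.blowup ?_ hx hz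
      show s.π.base z ∈ (s.D : Set A.Z)ᶜ
      rw [hz]
      exact hx
  rw [heq]
  exact hcl.preimage s.π.continuous

/-- **Off the centre the germ is unchanged**: for a typed step `s` blowing up the closed point `ξ` and `x′ ∈ Sing(E′)` not
over `ξ`, `π x′ ∈ Sing(E)` and `J′_{x′}` is the image of `J_{π x′}` under the isomorphism `π^♯ : 𝒪_{Z,π x′} ≅ 𝒪_{Z′,x′}`;
in particular `CuspAt` / `MohWindowAt` pass from `π x′` to `x′`. [cite: StacksProject, Tag 02OS] -/
theorem Step.cuspAt_and_mohWindowAt_of_ne (s : Step R A') {ξ : A.Z} (hDξ : (s.D : Set A.Z) = {ξ}) {x' : A'.Z}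
    (hx' : x' ∈ s.E'.sing) (hπx : s.π.base x' ≠ ξ) :
    s.π.base x' ∈ E.sing ∧
      (CuspAt E.b (A.Z.presheaf.stalk (s.π.base x')) (stalkIdeal E.J (s.π.base x')) →
        CuspAt E.b (A'.Z.presheaf.stalk x') (stalkIdeal s.E'.J x')) ∧
      (MohWindowAt E.b (A.Z.presheaf.stalk (s.π.base x')) (stalkIdeal E.J (s.π.base x')) →
        MohWindowAt E.b (A'.Z.presheaf.stalk x') (stalkIdeal s.E'.J x')) := by
  haveI : IsLocallyNoetherian A'.Z := by
    haveI := A'.smooth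
    exact LocallyOfFiniteType.isLocallyNoetherian A'.hom
  have hnot : s.π.base x' ∉ (vanishingIdeal s.D).support := by
    rw [← SetLike.mem_coe, coe_support_vanishingIdeal, hDξ]
    exact hπx
  haveI := s.blowup.isIso_stalkMap_of_not_mem_support hnot
  let ε : A.Z.presheaf.stalk (s.π.base x') ≃+* A'.Z.presheaf.stalk x' :=
    (asIso (s.π.stalkMap x')).commRingCatIsoToRingEquiv
  have hε : (ε : A.Z.presheaf.stalk (s.π.base x') →+* A'.Z.presheaf.stalk x') = (s.π.stalkMap x').hom := rfl
  have hJ' : stalkIdeal s.E'.J x' = (stalkIdeal E.J (s.π.base x')).map (ε : _ →+* _) := by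
    rw [hε]
    exact stalkIdeal_controlledTransform_of_not_mem_support E.J E.b hnot
  refine ⟨(s.mem_sing_and_cuspIndexAt_eq_of_ne hDξ hx' hπx).1, fun h => ?_, fun h => ?_⟩
  · rw [hJ']
    exact Cusp.cuspAt_map_of_ringEquiv ε h
  · rw [hJ']
    exact Cusp.mohWindowAt_map_of_ringEquiv ε h

/-! ## The Moh window on curves propagates -/

/-- [OURS · L1 W4.6 rung (iii); NOT a statement of the manuscript] **The window regime is stable under every typed step.**
If `(Z, E) ∈ Regime.mohWindowCurve` and `s` is a step admitted by the typed centre rule (any notion instance, any résumé),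
then `(Z′, E′) ∈ Regime.mohWindowCurve`: `Sing(E′)` is finite (`Step.sing_finite_of_mohWindowCurve`), no point over the
blown-up point `ξ` is singular (`MohWindow.idealOrder_controlledTransform_lt`), and off `ξ` the points of `Sing(E′)` are
closed with the same window germs (`Step.isClosed_singleton_of_not_mem`, `Step.cuspAt_and_mohWindowAt_of_ne`).
[folklore] -/
theorem Step.mohWindowCurve_transform (s : Step R A') (hRg : Regime.mohWindowCurve A E) :
    Regime.mohWindowCurve A' s.E' := by
  classical
  obtain ⟨ξ, hξS, hξcl, hDξ⟩ := s.centre.exists_eq_singleton_of_mohWindowCurve hRg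
  have hfin' : s.E'.sing.Finite := s.sing_finite_of_mohWindowCurve hRg
  obtain ⟨-, hcl, hwin⟩ := hRg
  haveI : IsLocallyNoetherian A'.Z := by
    haveI := A'.smooth
    exact LocallyOfFiniteType.isLocallyNoetherian A'.hom
  -- no singular point of `E′` lies over `ξ`
  have hne : ∀ x' ∈ s.E'.sing, s.π.base x' ≠ ξ := by
    intro x' hx' heq
    have hY : stalkIdeal (vanishingIdeal s.D) (s.π.base x') =
        maximalIdeal (A.Z.presheaf.stalk (s.π.base x')) := by
      apply stalkIdeal_vanishingIdeal_eq_maximalIdeal_of_closure_eq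
      rw [hDξ, heq, hξcl.closure_eq]
    have hW : MohWindowAt E.b (A.Z.presheaf.stalk (s.π.base x')) (stalkIdeal E.J (s.π.base x')) :=
      hwin _ (heq ▸ hξS)
    have hlt := MohWindow.idealOrder_controlledTransform_lt s.blowup hY hW
    have hx'b : (E.b : ℕ∞) ≤ idealOrder (controlledTransform s.π (vanishingIdeal s.D) E.J E.b) x' := hx'
    exact (not_le.mpr hlt) hx'b
  refine ⟨hfin', fun x' hx' => ?_, fun x' hx' => ?_⟩
  · obtain ⟨hS, -, -⟩ := s.cuspAt_and_mohWindowAt_of_ne hDξ hx' (hne x' hx')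
    refine s.isClosed_singleton_of_not_mem ?_ (hcl hS)
    rw [hDξ]
    exact hne x' hx'
  · obtain ⟨hS, -, hW⟩ := s.cuspAt_and_mohWindowAt_of_ne hDξ hx' (hne x' hx')
    exact hW (hwin _ hS)

/-- [OURS · L1 W4.6 rung (iii); NOT a statement of the manuscript] Along a run of the typed procedure (any `N`, `Rd`), the
window regime at stage `0` forces it at every stage. [folklore] -/
theorem Run.mohWindowCurve_of_zero {Rd : Reading p K N} (r : Run N Rd)
    (h0 : Regime.mohWindowCurve (p := p) (K := K) (r.A 0) (r.E 0)) (k : ℕ) :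
    Regime.mohWindowCurve (p := p) (K := K) (r.A k) (r.E k) := by
  induction k with
  | zero => exact h0
  | succ k ih =>
    rw [r.E_succ k]
    exact (r.step k).mohWindowCurve_transform ih

/-- [OURS · L1 W4.6 rung (iii); NOT a statement of the manuscript] **No infinite run of the typed Th. 16.6 procedure starts
in the Moh window on curves** — the INPUT-ONLY form of the rung `MohWindowCurveTerminates` (`terminates_mohWindowCurve` +
`Run.mohWindowCurve_of_zero`): for every `N`, `Rd` and every run `r`, stage `0` is not a window state. [folklore] -/
theorem Run.not_mohWindowCurve_zero {Rd : Reading p K N} (r : Run N Rd) :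
    ¬ Regime.mohWindowCurve (p := p) (K := K) (r.A 0) (r.E 0) :=
  fun h0 => terminates_mohWindowCurve N Rd r (r.mohWindowCurve_of_zero h0)

/-- [OURS · L1 W4.6 rung (iii); NOT a statement of the manuscript] For EVERY regime `Rg` (in particular `Regime.top`: no
regime at all), the typed procedure admits no infinite run from a window state `(A₀, E₀)` inside `Rg`
(`¬ DivergesFrom N Rd Rg A₀ E₀`, the W4.7 negative-side shape). [folklore] -/
theorem not_divergesFrom_of_mohWindowCurve (N : Notions.{u} n) (Rd : Reading p K N) (Rg : Regime p K)
    {A₀ : AmbientDatum p K} {E₀ : IdealExponent A₀.Z} (h : Regime.mohWindowCurve (p := p) (K := K) A₀ E₀) :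
    ¬ DivergesFrom N Rd Rg A₀ E₀ := by
  rintro ⟨r, -⟩
  refine r.toRun.not_mohWindowCurve_zero ?_
  show Regime.mohWindowCurve A₀ (r.E 0)
  rw [r.E_zero]
  exact h

/-- [OURS · L1 W4.6 rung (iii); NOT a statement of the manuscript] The same for the ∇-centred procedure: no infinite
∇-centred run from a window state, inside any regime (`¬ DivergesFromNabla N Rd Rg A₀ E₀`). [folklore] -/
theorem not_divergesFromNabla_of_mohWindowCurve (N : Notions.{u} n) (Rd : Reading p K N) (Rg : Regime p K)
    {A₀ : AmbientDatum p K} {E₀ : IdealExponent A₀.Z} (h : Regime.mohWindowCurve (p := p) (K := K) A₀ E₀) :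
    ¬ DivergesFromNabla N Rd Rg A₀ E₀ := by
  rintro ⟨r, -⟩
  refine r.toRunNabla.toRun.not_mohWindowCurve_zero ?_
  show Regime.mohWindowCurve A₀ (r.E 0)
  rw [r.E_zero]
  exact h

/-! ## The cusp staircase propagates -/

/-- [OURS · L1 W4.6 rung (iii); NOT a statement of the manuscript] **The staircase regime is stable under every typed
step.** If `(Z, E) ∈ Regime.cuspCurve` and `s` is a step admitted by the typed centre rule (any notion instance, any
résumé), then `(Z′, E′) ∈ Regime.cuspCurve`: the exponent is unchanged, `Sing(E′)` is finite
(`Step.sing_finite_and_ncard_le_of_cuspCurve`), the singular point over the blown-up point `ξ` (if any) is a cusp point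
(`Step.cuspAt_and_cuspIndexAt_le_of_over`) and CLOSED (`Cusp.isClosed_singleton_of_le`: residue field `κ(ξ)`, Stacks 01TB),
and off `ξ` the points of `Sing(E′)` are closed with the same cusp germs (`Step.isClosed_singleton_of_not_mem`,
`Step.cuspAt_and_mohWindowAt_of_ne`). [folklore] -/
theorem Step.cuspCurve_transform (s : Step R A') (hRg : Regime.cuspCurve A E) :
    Regime.cuspCurve A' s.E' := by
  classical
  obtain ⟨ξ, hξS, hξcl, hDξ⟩ := s.centre.exists_eq_singleton_of_cuspCurve hRg
  have hfin' : s.E'.sing.Finite := (s.sing_finite_and_ncard_le_of_cuspCurve hRg).1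
  have hRg' := hRg
  obtain ⟨hb, -, hcl, hcusp⟩ := hRg
  haveI : IsLocallyNoetherian A'.Z := by
    haveI := A'.smooth
    exact LocallyOfFiniteType.isLocallyNoetherian A'.hom
  haveI := A.smooth
  haveI := A'.smooth
  haveI : JacobsonSpace A.Z := LocallyOfFiniteType.jacobsonSpace A.hom
  haveI : LocallyOfFiniteType s.π := by
    have h : LocallyOfFiniteType (s.π ≫ A.hom) := by
      rw [← s.hom_eq]
      infer_instance
    exact locallyOfFiniteType_of_comp s.π A.hom
  refine ⟨hb, hfin', fun x' hx' => ?_, fun x' hx' => ?_⟩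
  · by_cases hπx : s.π.base x' = ξ
    · -- over the centre: the chart origin, a closed point
      obtain ⟨hnd, hshape⟩ := Cusp.cuspIndex_spec (hcusp ξ hξS)
      have hbd : E.b < cuspIndexAt E ξ :=
        Cusp.lt_of_cuspShape_of_le_pow hshape hnd (stalkIdeal_le_pow_of_mem_sing hξS)
      have hY : stalkIdeal (vanishingIdeal s.D) ξ = maximalIdeal (A.Z.presheaf.stalk ξ) := by
        apply stalkIdeal_vanishingIdeal_eq_maximalIdeal_of_closure_eq
        rw [hDξ, hξcl.closure_eq]
      subst hπx
      have hx'b : (E.b : ℕ∞) ≤ idealOrder (controlledTransform s.π (vanishingIdeal s.D) E.J E.b) x' := hx'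
      exact Cusp.isClosed_singleton_of_le s.blowup hb hbd hξcl hY hshape hx'b
    · obtain ⟨hS, -, -⟩ := s.cuspAt_and_mohWindowAt_of_ne hDξ hx' hπx
      refine s.isClosed_singleton_of_not_mem ?_ (hcl hS)
      rw [hDξ]
      exact hπx
  · by_cases hπx : s.π.base x' = ξ
    · exact (s.cuspAt_and_cuspIndexAt_le_of_over hRg' hDξ hx' hπx).1
    · obtain ⟨hS, hC, -⟩ := s.cuspAt_and_mohWindowAt_of_ne hDξ hx' hπx
      exact hC (hcusp _ hS)

/-- [OURS · L1 W4.6 rung (iii); NOT a statement of the manuscript] Along a run of the typed procedure (any `N`, `Rd`), the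
staircase regime at stage `0` forces it at every stage. [folklore] -/
theorem Run.cuspCurve_of_zero {Rd : Reading p K N} (r : Run N Rd)
    (h0 : Regime.cuspCurve (p := p) (K := K) (r.A 0) (r.E 0)) (k : ℕ) :
    Regime.cuspCurve (p := p) (K := K) (r.A k) (r.E k) := by
  induction k with
  | zero => exact h0
  | succ k ih =>
    rw [r.E_succ k]
    exact (r.step k).cuspCurve_transform ih

/-- [OURS · L1 W4.6 rung (iii); NOT a statement of the manuscript] **No infinite run of the typed Th. 16.6 procedure starts
on the cusp staircase** — the INPUT-ONLY form of the rung `CuspCurveTerminates` (`terminates_cuspCurve` +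
`Run.cuspCurve_of_zero`): for every `N`, `Rd` and every run `r`, stage `0` is not a staircase state. Equivalently, with
`Run.exists_exit_le_sum_div_of_cuspCurve`: a run from a staircase input would leave the regime by stage `Σ(E₀)/b`, which
`Run.cuspCurve_of_zero` forbids. [folklore] -/
theorem Run.not_cuspCurve_zero {Rd : Reading p K N} (r : Run N Rd) :
    ¬ Regime.cuspCurve (p := p) (K := K) (r.A 0) (r.E 0) :=
  fun h0 => terminates_cuspCurve N Rd r (r.cuspCurve_of_zero h0)

/-- [OURS · L1 W4.6 rung (iii); NOT a statement of the manuscript] For EVERY regime `Rg` (in particular `Regime.top`), the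
typed procedure admits no infinite run from a staircase state `(A₀, E₀)` inside `Rg` (`¬ DivergesFrom N Rd Rg A₀ E₀`).
[folklore] -/
theorem not_divergesFrom_of_cuspCurve (N : Notions.{u} n) (Rd : Reading p K N) (Rg : Regime p K)
    {A₀ : AmbientDatum p K} {E₀ : IdealExponent A₀.Z} (h : Regime.cuspCurve (p := p) (K := K) A₀ E₀) :
    ¬ DivergesFrom N Rd Rg A₀ E₀ := by
  rintro ⟨r, -⟩
  refine r.toRun.not_cuspCurve_zero ?_
  show Regime.cuspCurve A₀ (r.E 0)
  rw [r.E_zero]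
  exact h

/-- [OURS · L1 W4.6 rung (iii); NOT a statement of the manuscript] The same for the ∇-centred procedure: no infinite
∇-centred run from a staircase state, inside any regime (`¬ DivergesFromNabla N Rd Rg A₀ E₀`). [folklore] -/
theorem not_divergesFromNabla_of_cuspCurve (N : Notions.{u} n) (Rd : Reading p K N) (Rg : Regime p K)
    {A₀ : AmbientDatum p K} {E₀ : IdealExponent A₀.Z} (h : Regime.cuspCurve (p := p) (K := K) A₀ E₀) :
    ¬ DivergesFromNabla N Rd Rg A₀ E₀ := by
  rintro ⟨r, -⟩
  refine r.toRunNabla.toRun.not_cuspCurve_zero ?_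
  show Regime.cuspCurve A₀ (r.E 0)
  rw [r.E_zero]
  exact h

/-- [OURS · L1 W4.6 rung (iii); NOT a statement of the manuscript] **Sub-regimes of the staircase terminate by their first
stage alone**: if every state of a regime `Rg` is a staircase state (`Rg ≤ Regime.cuspCurve` pointwise), then
`Terminates N Rd Rg` and `TerminatesNabla N Rd Rg` — and the proofs use the hypothesis `Rg` at stage `0` only
(`Run.not_cuspCurve_zero`). Bookkeeping for sub-regimes such as the window regime at singular states
(`Regime.cuspCurve_of_mohWindowCurve`). [folklore] -/
theorem terminates_of_le_cuspCurve (N : Notions.{u} n) (Rd : Reading p K N) {Rg : Regime p K}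
    (hle : ∀ A E, Rg A E → Regime.cuspCurve (p := p) (K := K) A E) :
    Terminates N Rd Rg ∧ TerminatesNabla N Rd Rg :=
  ⟨fun r hr => r.not_cuspCurve_zero (hle _ _ (hr 0)),
    fun r hr => r.toRun.not_cuspCurve_zero (hle _ _ (hr 0))⟩

end Campaign

end CampaignW46

end Summit.ResolutionOfSingularities.ResolutionOfSingularities.Theorems

end
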